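import Literature.AlgebraicGeometry.Resolution.LogRegularDimensionBound
import HarnessLib

/-!
# Crux `FrobeniusLadder.FRationalResolution` (stmt-ResolutionOfSingularities-15317), line `redirect`,
# stub `stub_diagonalizableQuotientResolution` — MONOMIAL ALGEBRAS AT THEIR VERTEX (item (E″) of MEMO-15317-leafhand2-g18 §2c)

For a field `κ`, a finite set `S ⊆ ℕⁿ ∖ {0}` of exponents, the monomial algebra
`T = κ[χᵈ : d ∈ S] ⊆ κ[x₁,…,xₙ]` (e.g. the Veronese cones `VR[n,r]`, the cyclic-quotient models `κ[P_w]`) and its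
vertex ideal `𝔳 = (χᵈ : d ∈ S)`:

* `monomial_mem_of_mem_closure` — `χᵖ ∈ T` for `p` in the exponent monoid `P = ⟨S⟩`;
* `exists_sub_algebraMap_mem_vertexIdeal` — every `t ∈ T` is a scalar modulo `𝔳`;
* `constantCoeff_eq_zero_of_mem_vertexIdeal`, `vertexIdeal_ne_top`, ★ `vertexIdeal_isMaximal` (`0 ∉ S`);
* `exists_sub_algebraMap_mem_maximalIdeal` — residue surjectivity `κ → T_𝔳/𝔳T_𝔳`;
* ★ `ringKrullDim_localization_le_rank` — Kato's inequality `dim T_𝔳 ≤ rank P` for the monomial chart.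

Honest label: plumbing toward ONE leaf stub (no stub, crux or summit closed). No definitions, no named facts, no sorry.
[folklore; cite: Kato1994, Lemma (2.3), Thm. (3.2)] [cite: CoxLittleSchenck2011, §1.1]
-/

noncomputable section

-- single-problem summit: the doubled namespace component is forced
set_option linter.dupNamespace false

open IsLocalRing MvPolynomial Literature.RingTheory.MvPowerSeries.monoidPowerSeries
open Literature.AlgebraicGeometry.Resolution

namespace Summit.ResolutionOfSingularities.ResolutionOfSingularities.Theorems.FRationalResolution.MonomialAlgebraVertex

variable (κ : Type) [Field κ] {n : ℕ}

/-- The monomial algebra `κ[χᵈ : d ∈ S] ⊆ κ[x₁,…,xₙ]`. -/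
local notation3 "T[" S "]" =>
  Algebra.adjoin κ ((fun d : Fin n →₀ ℕ => MvPolynomial.monomial d (1 : κ)) '' S)

/-- The vertex ideal `(χᵈ : d ∈ S)` of the monomial algebra. -/
local notation3 "V[" S "]" =>
  Ideal.span {v : ↥T[S] | ∃ d ∈ S, (v : MvPolynomial (Fin n) κ) = MvPolynomial.monomial d 1}

/-- `χᵖ ∈ κ[χᵈ : d ∈ S]` for every `p` in the submonoid generated by `S`. [folklore] -/
theorem monomial_mem_of_mem_closure (S : Set (Fin n →₀ ℕ)) {p : Fin n →₀ ℕ}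
    (hp : p ∈ AddSubmonoid.closure S) : MvPolynomial.monomial p (1 : κ) ∈ T[S] := by
  induction hp using AddSubmonoid.closure_induction with
  | mem x hx => exact Algebra.subset_adjoin ⟨x, hx, rfl⟩
  | zero => exact Subalgebra.one_mem _
  | add x y _ _ hx hy =>
    have : MvPolynomial.monomial (x + y) (1 : κ) = MvPolynomial.monomial x 1 * MvPolynomial.monomial y 1 := by
      rw [MvPolynomial.monomial_mul, mul_one]
    rw [this]
    exact Subalgebra.mul_mem _ hx hy

/-- Every element of the monomial algebra is congruent to a scalar modulo the vertex ideal. [folklore] -/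
theorem exists_sub_algebraMap_mem_vertexIdeal (S : Set (Fin n →₀ ℕ)) (t : ↥T[S]) :
    ∃ c : κ, t - algebraMap κ (↥T[S]) c ∈ V[S] := by
  obtain ⟨t, ht⟩ := t
  induction ht using Algebra.adjoin_induction with
  | mem x hx =>
    obtain ⟨d, hd, rfl⟩ := hx
    refine ⟨0, ?_⟩
    rw [map_zero, sub_zero]
    exact Ideal.subset_span ⟨d, hd, rfl⟩
  | algebraMap c =>
    refine ⟨c, ?_⟩
    have : (⟨algebraMap κ (MvPolynomial (Fin n) κ) c, Subalgebra.algebraMap_mem _ c⟩ : ↥T[S]) =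
        algebraMap κ (↥T[S]) c := rfl
    rw [this, sub_self]
    exact Ideal.zero_mem _
  | add x y hx hy ihx ihy =>
    obtain ⟨c₁, h₁⟩ := ihx
    obtain ⟨c₂, h₂⟩ := ihy
    refine ⟨c₁ + c₂, ?_⟩
    have : (⟨x + y, Subalgebra.add_mem _ hx hy⟩ : ↥T[S]) - algebraMap κ (↥T[S]) (c₁ + c₂) =
        (⟨x, hx⟩ - algebraMap κ (↥T[S]) c₁) + (⟨y, hy⟩ - algebraMap κ (↥T[S]) c₂) := by
      rw [map_add]; exact Subtype.ext (by push_cast; ring)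
    rw [this]
    exact Ideal.add_mem _ h₁ h₂
  | mul x y hx hy ihx ihy =>
    obtain ⟨c₁, h₁⟩ := ihx
    obtain ⟨c₂, h₂⟩ := ihy
    refine ⟨c₁ * c₂, ?_⟩
    have : (⟨x * y, Subalgebra.mul_mem _ hx hy⟩ : ↥T[S]) - algebraMap κ (↥T[S]) (c₁ * c₂) =
        (⟨x, hx⟩ - algebraMap κ (↥T[S]) c₁) * ⟨y, hy⟩ +
          algebraMap κ (↥T[S]) c₁ * (⟨y, hy⟩ - algebraMap κ (↥T[S]) c₂) := by
      rw [map_mul]; exact Subtype.ext (by push_cast; ring)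
    rw [this]
    exact Ideal.add_mem _ (Ideal.mul_mem_right _ _ h₁) (Ideal.mul_mem_left _ _ h₂)

/-- Elements of the vertex ideal have zero constant coefficient (`0 ∉ S`). [folklore] -/
theorem constantCoeff_eq_zero_of_mem_vertexIdeal (S : Set (Fin n →₀ ℕ)) (h0 : (0 : Fin n →₀ ℕ) ∉ S)
    {v : ↥T[S]} (hv : v ∈ V[S]) : MvPolynomial.constantCoeff (v : MvPolynomial (Fin n) κ) = 0 := by
  induction hv using Submodule.span_induction with
  | mem x hx =>
    obtain ⟨d, hd, hx⟩ := hx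
    rw [hx, MvPolynomial.constantCoeff_monomial, if_neg]
    rintro rfl
    exact h0 hd
  | zero => simp
  | add x y _ _ hx hy =>
    rw [Subalgebra.coe_add, map_add, hx, hy, add_zero]
  | smul a x _ hx =>
    rw [smul_eq_mul, Subalgebra.coe_mul, map_mul, hx, mul_zero]

/-- The vertex ideal is proper (`0 ∉ S`). [folklore] -/
theorem vertexIdeal_ne_top (S : Set (Fin n →₀ ℕ)) (h0 : (0 : Fin n →₀ ℕ) ∉ S) : V[S] ≠ ⊤ := by
  intro h
  have h1 : (1 : ↥T[S]) ∈ V[S] := h ▸ Submodule.mem_top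
  have := constantCoeff_eq_zero_of_mem_vertexIdeal κ S h0 h1
  rw [Subalgebra.coe_one, map_one] at this
  exact one_ne_zero this

/-- ★ **The vertex ideal is maximal** with residue field `κ` (`0 ∉ S`). [folklore] -/
theorem vertexIdeal_isMaximal (S : Set (Fin n →₀ ℕ)) (h0 : (0 : Fin n →₀ ℕ) ∉ S) : (V[S]).IsMaximal := by
  refine ⟨⟨vertexIdeal_ne_top κ S h0, fun J hJ => ?_⟩⟩
  obtain ⟨t, htJ, htV⟩ := Set.exists_of_ssubset hJ
  obtain ⟨c, hc⟩ := exists_sub_algebraMap_mem_vertexIdeal κ S t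
  have hc0 : c ≠ 0 := by
    rintro rfl
    rw [map_zero, sub_zero] at hc
    exact htV hc
  have hcJ : algebraMap κ (↥T[S]) c ∈ J := by
    have : algebraMap κ (↥T[S]) c = t - (t - algebraMap κ (↥T[S]) c) := by ring
    rw [this]
    exact Ideal.sub_mem _ htJ (hJ.le hc)
  rw [Ideal.eq_top_iff_one]
  have : (1 : ↥T[S]) = algebraMap κ (↥T[S]) c⁻¹ * algebraMap κ (↥T[S]) c := by
    rw [← map_mul, inv_mul_cancel₀ hc0, map_one]
  rw [this]
  exact Ideal.mul_mem_left _ _ hcJ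

/-- Residue surjectivity at the vertex: every element of `T_𝔳` is a scalar modulo `𝔪 = 𝔳T_𝔳`. [folklore] -/
theorem exists_sub_algebraMap_mem_maximalIdeal (S : Set (Fin n →₀ ℕ)) [h𝔳 : (V[S]).IsMaximal]
    (x : Localization.AtPrime V[S]) :
    ∃ c : κ, x - algebraMap κ (Localization.AtPrime V[S]) c ∈ maximalIdeal (Localization.AtPrime V[S]) := by
  obtain ⟨⟨t, s⟩, rfl⟩ := IsLocalization.mk'_surjective (V[S]).primeCompl x
  dsimp only
  obtain ⟨c, hc⟩ := exists_sub_algebraMap_mem_vertexIdeal κ S t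
  obtain ⟨c', hc'⟩ := exists_sub_algebraMap_mem_vertexIdeal κ S (s : ↥T[S])
  have hc'0 : c' ≠ 0 := by
    rintro rfl
    rw [map_zero, sub_zero] at hc'
    exact s.2 hc'
  refine ⟨c / c', ?_⟩
  have key : t - algebraMap κ (↥T[S]) (c / c') * (s : ↥T[S]) ∈ V[S] := by
    have h : algebraMap κ (↥T[S]) (c / c') * algebraMap κ (↥T[S]) c' = algebraMap κ (↥T[S]) c := by
      rw [← map_mul, div_mul_cancel₀ c hc'0]
    have : t - algebraMap κ (↥T[S]) (c / c') * (s : ↥T[S]) =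
        (t - algebraMap κ (↥T[S]) c) -
          algebraMap κ (↥T[S]) (c / c') * ((s : ↥T[S]) - algebraMap κ (↥T[S]) c') := by
      linear_combination -h
    rw [this]
    exact Ideal.sub_mem _ hc (Ideal.mul_mem_left _ _ hc')
  have hu : IsUnit (algebraMap (↥T[S]) (Localization.AtPrime V[S]) (s : ↥T[S])) :=
    IsLocalization.map_units (Localization.AtPrime V[S]) s
  rw [← Ideal.mul_unit_mem_iff_mem _ hu]
  have e1 : (IsLocalization.mk' (Localization.AtPrime V[S]) t s -
        algebraMap κ (Localization.AtPrime V[S]) (c / c')) *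
      algebraMap (↥T[S]) (Localization.AtPrime V[S]) (s : ↥T[S]) =
      algebraMap (↥T[S]) (Localization.AtPrime V[S]) (t - algebraMap κ (↥T[S]) (c / c') * (s : ↥T[S])) := by
    have h1 : IsLocalization.mk' (Localization.AtPrime V[S]) t s *
        algebraMap (↥T[S]) (Localization.AtPrime V[S]) (s : ↥T[S]) =
        algebraMap (↥T[S]) (Localization.AtPrime V[S]) t := IsLocalization.mk'_spec _ t s
    have h2 : algebraMap κ (Localization.AtPrime V[S]) (c / c') =
        algebraMap (↥T[S]) (Localization.AtPrime V[S]) (algebraMap κ (↥T[S]) (c / c')) :=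
      IsScalarTower.algebraMap_apply κ (↥T[S]) (Localization.AtPrime V[S]) _
    rw [map_sub, map_mul, ← h1, h2]
    ring
  rw [e1, ← Localization.AtPrime.map_eq_maximalIdeal]
  exact Ideal.mem_map_of_mem _ key

/-- The monomial algebra of a finite set of exponents is of finite type over `κ`. [folklore] -/
theorem finiteType (S : Set (Fin n →₀ ℕ)) (hS : S.Finite) : Algebra.FiniteType κ (↥T[S]) :=
  (Subalgebra.fg_iff_finiteType _).1 ⟨(hS.image _).toFinset, by rw [Set.Finite.coe_toFinset]⟩

/-- `χᵖ ∈ 𝔳` for every NONZERO `p` of the exponent monoid `⟨S⟩`. [folklore] -/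
theorem monomial_mem_vertexIdeal (S : Set (Fin n →₀ ℕ)) {p : Fin n →₀ ℕ} (hp : p ∈ AddSubmonoid.closure S)
    (hp0 : p ≠ 0) : (⟨MvPolynomial.monomial p (1 : κ), monomial_mem_of_mem_closure κ S hp⟩ : ↥T[S]) ∈ V[S] := by
  induction hp using AddSubmonoid.closure_induction with
  | mem x hx => exact Ideal.subset_span ⟨x, hx, rfl⟩
  | zero => exact absurd rfl hp0
  | add x y hx hy ihx ihy =>
    by_cases hx0 : x = 0
    · subst hx0
      have : (⟨MvPolynomial.monomial (0 + y) (1 : κ), monomial_mem_of_mem_closure κ S (add_mem hx hy)⟩ : ↥T[S]) =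
          ⟨MvPolynomial.monomial y 1, monomial_mem_of_mem_closure κ S hy⟩ :=
        Subtype.ext (by show MvPolynomial.monomial (0 + y) (1 : κ) = _; rw [zero_add])
      rw [this]
      exact ihy (by simpa using hp0)
    · have : (⟨MvPolynomial.monomial (x + y) (1 : κ), monomial_mem_of_mem_closure κ S (add_mem hx hy)⟩ : ↥T[S]) =
          ⟨MvPolynomial.monomial x 1, monomial_mem_of_mem_closure κ S hx⟩ *
            ⟨MvPolynomial.monomial y 1, monomial_mem_of_mem_closure κ S hy⟩ :=
        Subtype.ext (by rw [Subalgebra.coe_mul, MvPolynomial.monomial_mul, mul_one])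
      rw [this]
      exact Ideal.mul_mem_right _ _ (ihx hx0)

/-- ★ **Kato's inequality at the vertex**: `dim T_𝔳 ≤ rank ⟨S⟩` for the monomial chart `p ↦ χᵖ`
(`𝔪_{T_𝔳}` is generated by the `χᵈ`, `d ∈ S`). [cite: Kato1994, Lemma (2.3)] -/
theorem ringKrullDim_localization_le_rank (S : Set (Fin n →₀ ℕ)) (hS : S.Finite) (h0 : (0 : Fin n →₀ ℕ) ∉ S)
    [h𝔳 : (V[S]).IsMaximal] (P : AddSubmonoid (Fin n →₀ ℕ)) (hP : AddSubmonoid.closure S = P) :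
    ringKrullDim (Localization.AtPrime V[S]) ≤ rank P := by
  classical
  subst hP
  haveI : Algebra.FiniteType κ (↥T[S]) := finiteType κ S hS
  haveI : IsNoetherianRing (↥T[S]) := Algebra.FiniteType.isNoetherianRing κ _
  haveI : IsNoetherianRing (Localization.AtPrime V[S]) :=
    IsLocalization.isNoetherianRing (V[S]).primeCompl _ inferInstance
  have hPfg : (AddSubmonoid.closure S).FG := ⟨hS.toFinset, by rw [Set.Finite.coe_toFinset]⟩
  let φ : (Fin n →₀ ℕ) → Localization.AtPrime V[S] := fun p =>
    if hp : p ∈ AddSubmonoid.closure S then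
      algebraMap (↥T[S]) _ ⟨MvPolynomial.monomial p 1, monomial_mem_of_mem_closure κ S hp⟩ else 0
  have hφ : ∀ p (hp : p ∈ AddSubmonoid.closure S),
      φ p = algebraMap (↥T[S]) _ ⟨MvPolynomial.monomial p 1, monomial_mem_of_mem_closure κ S hp⟩ :=
    fun p hp => dif_pos hp
  refine LogRegularCompleteStructure.ringKrullDim_le_rank (A := Localization.AtPrime V[S]) (φ := φ) hPfg ?_ ?_ ?_ ?_
  · rw [hφ 0 (zero_mem _)]
    have h1 : (⟨MvPolynomial.monomial 0 1, monomial_mem_of_mem_closure κ S (zero_mem _)⟩ : ↥T[S]) = 1 :=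
      Subtype.ext (by simp)
    rw [h1, map_one]
  · intro a ha b hb
    rw [hφ a ha, hφ b hb, hφ (a + b) (add_mem ha hb), ← map_mul]
    congr 1
    exact Subtype.ext (by rw [Subalgebra.coe_mul, MvPolynomial.monomial_mul, mul_one])
  · intro p hp hp0
    rw [hφ p hp, ← Localization.AtPrime.map_eq_maximalIdeal]
    exact Ideal.mem_map_of_mem _ (monomial_mem_vertexIdeal κ S hp hp0)
  · rw [← Localization.AtPrime.map_eq_maximalIdeal, Ideal.map_span]
    apply Ideal.span_mono
    rintro _ ⟨v, ⟨d, hd, hv⟩, rfl⟩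
    have hd' : d ∈ AddSubmonoid.closure S := AddSubmonoid.subset_closure hd
    refine ⟨d, ⟨hd', ?_⟩, ?_⟩
    · rintro rfl; exact h0 hd
    · rw [hφ d hd']
      congr 1
      exact Subtype.ext hv.symm

end Summit.ResolutionOfSingularities.ResolutionOfSingularities.Theorems.FRationalResolution.MonomialAlgebraVertex

end
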